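import Literature.AlgebraicGeometry.Motives.OsculatingLinesChowTwo
import Literature.AlgebraicGeometry.Motives.TangentLineFamilyCycle
import HarnessLib

/-!
# `CH₂(X) = ℤ · H^{d-2} + ⟨planes⟩` for cubic hypersurfaces of dimension `d ≥ 14`

R. Mboro, *Remarks on the `CH₂` of cubic hypersurfaces* (arXiv:1701.04488). The proof of Cor. 2.9
(`CH₂(X)` is generated by planes for smooth cubics of dimension `n ≥ 7`) combines TWO relations
with coprime coefficients: Thm. 1.2 — `3 Γ + P_*(γ) ∈ ℤ · H_X^{n-2}` (osculating lines; in the tree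
as `Motives/OsculatingLinesChowTwo`, `3 · CH₂(X) ⊆ ℤ h + ⟨planes⟩` for `d ≥ 14`) — and Thm. 1.3 —
`2 Γ ∈ Im P_* + ℤ · H_X^{n-2}`, from the lines TANGENT to `X` along a linear subspace of `X`
(p. 8: "the residual point to `x` (`x` has multiplicity `2`) in the intersection `X ∩ l_{(x,v)}`"),
"so that, putting the two steps together, we get `(3-2)Γ + P_*(⋯) ∈ ℤ · H_X^{n-i}`" (p. 8).

This file proves an elementary cycle-level version of the SECOND relation and the combination, for
an integral cubic hypersurface `X = V₊(F) ⊆ ℙᵈ⁺¹_k` over an algebraically closed field with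
`d ≥ 14`, the term `P_*(⋯)` being rendered by planes of `X`:

* `ProjFamily.exists_two_smul_primeCycle_sub_mem` — **for every point `z ∈ X` of dimension `2`
  there are `a ∈ ℤ` and a cycle `Pl` supported on plane points with
  `2 [closure {z}] - a · [X ∩ M] - Pl ∈ Rat₂(X)`** (`M` a `3`-plane not on `X`). Construction
  (the tangent lines of Thm. 1.3 through the generic point, aimed at a plane of `X`): let `K = κ(z)`,
  `[p₀] ∈ X(K)` the generic point of `S = closure {z}` and `P = ℙ(W) ⊆ X` a plane (`W ⊆ kᵈ⁺²`
  isotropic of dimension `3`, `N ≥ 8`). The differential of `F` at `p₀` has a non-zero zero `β₀` on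
  `W_K` (a direction in `P` tangent to `X` at `[p₀]`); then `F(s p₀ + t β₀) = Q(β₀) s t²`
  (`ProjSpace.eval_add_smul_eq_of_coeff_two`). If `Q(β₀) ≠ 0` the `K`-line `l = [p₀][β₀]` is
  tangent to `X` at `[p₀]` with residual point `[β₀] ∈ P(K)`, and spreading it out over a surface
  `T` with `k(T) = K` (`Motives/ProductTrickBase`) gives, for the threefold `W♯` swept out,
  `pr₁^*V₊(F) · [W♯] = 2 [σ_{p₀}] + [σ_{β₀}] + (vertical)` (`Motives/TangentLineFamilyCycle`); its
  push-forward restricted to `X` is `≡ a · [X ∩ M]` (projection formula and Gysin,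
  `exists_restrictMapFst_primeInter_sub_mem`), `σ_{p₀} ↦ [S]`, `σ_{β₀} ↦ m [P]` (its image lies in
  the plane `P`) and the vertical components `↦` planes (`d ≥ 14`,
  `exists_planes_restrictMapFst_of_vertical`). If `Q(β₀) = 0` the line lies on `X` and the two
  sections differ by planes directly (`exists_relation_of_line_over_T`), `[S] ≡ m [P] + (planes)`.
* `ProjFamily.exists_primeCycle_sub_mem` — with `Motives/OsculatingLinesChowTwo` (`3 [S] ≡ ⋯`):
  **`[closure {z}] - a · [X ∩ M] - Pl ∈ Rat₂(X)`**, i.e.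
* `ProjFamily.mem_zmultiples_sup_closure_linearSubspaceClasses` —
  **`CH₂(X) = ℤ · (c₁(𝒪_X(1))^{d-2} ∩ [X]) + ⟨plane classes⟩`** for every integral cubic
  hypersurface of dimension `d ≥ 14` over an algebraically closed field.

Everything is proved; no named facts.

## References

* [Mboro2018] R. Mboro, Remarks on the CH₂ of cubic hypersurfaces, Geom. Dedicata 200 (2018) =
  arXiv:1701.04488: Thm. 1.2 (p. 6), proof of Thm. 1.3 (p. 8), Cor. 2.9 (p. 12).
* [Fulton1998] W. Fulton, Intersection Theory, 2nd ed. (1998), §1.4, Def. 2.3, Prop. 2.3,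
  Cor. 2.4.1.
* [TianZong2014] Z. Tian, H. R. Zong, One-cycles on rationally connected varieties, Compositio
  Math. 150 (2014), proof of Prop. 7.2 (the family technique).
-/

noncomputable section

open CategoryTheory CategoryTheory.Limits AlgebraicGeometry Order MonoidalCategory Topology
  TopologicalSpace Opposite
open MvPolynomial hiding X
open Literature.AlgebraicGeometry.Motives.Segre Literature.AlgebraicGeometry.Motives.RatFn
  Literature.RingTheory.OrderOfVanishing

universe u

namespace Literature.AlgebraicGeometry.Motives

attribute [local instance] MvPolynomial.gradedAlgebra MvPolynomial.algebraMvPolynomial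
  Literature.AlgebraicGeometry.Motives.ProjBaseChange.algebraBase
  UniversalHyperplaneSection.sectionsAlgebra ProjFamily.functionFieldAlgebra

namespace ProjFamily

open ProjBaseChangeRing ProjectiveSpaceCells ProjectiveSpace FanoScheme ProjSpace
  Literature.RingTheory.MvPolynomial Literature.FieldTheory.QuasiAlgClosed

/-! ### A tangent or contained direction inside a plane of the cubic -/

section Algebra

variable {K : Type u} [Field K] {N : ℕ}

/-- **A tangent direction inside a plane.** Let `F` be a cubic form over `K`, `p₀` a zero of `F`,
and `W` an isotropic subspace of `F` (`F ≡ 0` on `W`) of dimension `≥ 2` not containing `p₀`. Then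
there is `β₀ ∈ W`, independent of `p₀`, at which the differential of `F` at `p₀` vanishes, so that
(`ProjSpace.eval_add_smul_eq_of_coeff_two`) `F(s p₀ + t β₀) = c · s t²` for all `s, t` with
`c = Q(β₀)`: the line `[p₀][β₀]` is tangent to `V₊(F)` at `[p₀]` and meets it again at `[β₀]`
(`c ≠ 0`), or lies on `V₊(F)` (`c = 0`). [cite: Mboro2018, Lemma 1.1 (p. 6) and proof of Thm. 1.3 (arXiv:1701.04488, p. 8)] -/
theorem exists_tangent_vector_mem {F : MvPolynomial (Fin (N + 1)) K} (hF : F.IsHomogeneous 3)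
    {p₀ : Fin (N + 1) → K} (hp₀ : eval p₀ F = 0) {W : Submodule K (Fin (N + 1) → K)}
    [FiniteDimensional K W] (hW : 2 ≤ Module.finrank K W) (hiso : ∀ v ∈ W, eval v F = 0)
    (hpW : p₀ ∉ W) :
    ∃ β₀ ∈ W, ∃ c : K, LinearIndependent K ![p₀, β₀] ∧
      ∀ s t : K, eval (s • p₀ + t • β₀) F = c * s * t ^ 2 := by
  classical
  have hL : (coeff (Finsupp.single 0 2) (linePoly p₀ F)).IsHomogeneous 1 := by
    have h := (isBihom_linePoly p₀ hF (Finsupp.single 0 2)).1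
    rwa [Finsupp.degree_single] at h
  obtain ⟨β₀, hβW, hβ0, hβL⟩ := exists_ne_zero_eval_eq_zero_of_isHomogeneous_one hL hW
  refine ⟨β₀, hβW, eval β₀ (coeff (Finsupp.single 0 1) (linePoly p₀ F)), ?_, fun s t => ?_⟩
  · refine LinearIndependent.pair_iff.2 fun s t hst => ?_
    by_cases hs : s = 0
    · rw [hs, zero_smul, zero_add] at hst
      exact ⟨hs, (smul_eq_zero.1 hst).resolve_right hβ0⟩
    · exfalso
      apply hpW
      have h : p₀ = (-(s⁻¹ * t)) • β₀ := by
        have h1 : s • p₀ = -(t • β₀) := eq_neg_of_add_eq_zero_left hst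
        calc p₀ = s⁻¹ • (s • p₀) := by rw [smul_smul, inv_mul_cancel₀ hs, one_smul]
          _ = (-(s⁻¹ * t)) • β₀ := by rw [h1, smul_neg, smul_smul, neg_smul]
      rw [h]
      exact W.smul_mem _ hβW
  · rw [eval_add_smul_eq_of_coeff_two hF hp₀ hβL, hiso β₀ hβW, mul_zero, zero_add]
    ring

end Algebra

/-! ### Relations over a surface base `T` -/

section OverT

variable {k : Type u} [Field k] [IsAlgClosed k] {d : ℕ} (T : SchemeOver k) [IsIntegral T.left]
  [IsProper T.hom] (X : SchemeOver k) [IsIntegral X.left] [LocallyOfFiniteType X.hom]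
  (i : X ⟶ projectiveSpace (d + 1) k) [IsClosedImmersion i.left]
  {F : MvPolynomial (Fin (d + 1 + 1)) k}

omit [IsAlgClosed k] [IsIntegral X.left] [LocallyOfFiniteType X.hom] in
/-- **A section with values in a plane pushes forward to a multiple of the plane.** For a
`k(T)`-point `[β]` of `ℙᵈ⁺¹` at which the equations `L_j` (over `k`) of a plane `P = V₊(L) ⊆ X`
vanish, the push-forward to `ℙᵈ⁺¹` of the surface `closure ι([β]) ⊆ ℙᵈ⁺¹ ×ₖ T`, restricted to
`X`, is `m [P]` for some `m ∈ ℕ` (its image lies in `P`; it is `P` with the degree of the section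
over it as coefficient if the image is all of `P`, and `0` otherwise — Fulton §1.4). [cite: Fulton1998, §1.4] -/
theorem exists_restrictMapFst_primeCycle_genericFibreι_eq_smul (hT2 : height (genericPoint T.left) = 2)
    {β : Fin (d + 1 + 1) → T.left.functionField} (hβ0 : β ≠ 0)
    {t : ℕ} {Lp : Fin t → MvPolynomial (Fin (d + 1 + 1)) k} (hLpli : LinearIndependent k Lp)
    (hLphom : ∀ j, (Lp j).IsHomogeneous 1) (ht : t + 3 = d + 1 + 1) (yP : ↥X.left)
    (hyP : (ProjectiveSpectrum.asHomogeneousIdeal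
      (𝒜 := homogeneousSubmodule (Fin (d + 1 + 1)) k) (i.left.base yP)).toIdeal = Ideal.span (Set.range Lp))
    (hβL : ∀ j, eval β (MvPolynomial.map (algebraMap k T.left.functionField) (Lp j)) = 0) :
    ∃ m : ℕ, restrictMapFst T X i (primeCycle (genericFibreι (d + 1) T
        (pointOfVec T.left.functionField β hβ0).pt)) = m • primeCycle yP := by
  classical
  haveI : IsProper (projectiveSpace (d + 1) k).hom := isProper_projectiveSpace (d + 1) k
  let fstP := (CartesianMonoidalCategory.fst (projectiveSpace (d + 1) k) T).left
  let βP : ↥(projectiveSpace (d + 1) T.left.functionField).left := (pointOfVec T.left.functionField β hβ0).pt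
  rw [restrictMapFst_apply, algebraicCycleMap_primeCycle_eq_nsmul]
  by_cases hm : AlgebraicCycle.mapCoeff fstP height height (genericFibreι (d + 1) T βP) = 0
  · refine ⟨0, ?_⟩
    change cycleRestrictClosed i.left (AlgebraicCycle.mapCoeff fstP height height (genericFibreι (d + 1) T βP) •
      primeCycle (fstP.base (genericFibreι (d + 1) T βP))) = _
    rw [hm, zero_nsmul, zero_nsmul, ← cycleRestrictClosedHom_apply, map_zero]
  · -- the image point `p = pr₁ ι([β])` has dimension `2` …
    have hh : height (genericFibreι (d + 1) T βP) = height (fstP.base (genericFibreι (d + 1) T βP)) := by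
      by_contra hne
      exact hm (by rw [AlgebraicCycle.mapCoeff, if_neg hne])
    have hβP0 : height βP = 0 := height_pt _
    have hιβ : height (genericFibreι (d + 1) T βP) = (2 : ℕ) := by
      rw [height_genericFibreι_apply (d + 1) T hT2 βP, hβP0, add_zero]
    have hp2 : height (fstP.base (genericFibreι (d + 1) T βP)) = (2 : ℕ) := hh ▸ hιβ
    -- … and lies on the plane `i(closure {yP}) = V₊(L)`, of dimension `2`: it is its generic point
    have hyP2 : height (i.left.base yP) = (2 : ℕ) := by
      have h := (ProjSpace.isLinearSubspacePoint_of_toIdeal_eq_span Lp hLpli hLphom (by omega) hyP).height_eq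
      rw [h]; congr 1; omega
    have hsp : i.left.base yP ⤳ fstP.base (genericFibreι (d + 1) T βP) := by
      rw [specializes_iff_mem_closure, closure_singleton_eq_zeroLocus]
      change fstP.base (genericFibreι (d + 1) T βP) ∈ ProjectiveSpectrum.zeroLocus _
        ((ProjectiveSpectrum.asHomogeneousIdeal (𝒜 := homogeneousSubmodule (Fin (d + 1 + 1)) k)
          (i.left.base yP)).toIdeal : Set (MvPolynomial (Fin (d + 1 + 1)) k))
      rw [hyP, ProjectiveSpectrum.zeroLocus_span]
      rintro _ ⟨j, rfl⟩
      change Lp j ∈ ProjectiveSpectrum.asHomogeneousIdeal (𝒜 := homogeneousSubmodule (Fin (d + 1 + 1)) k)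
        ((CartesianMonoidalCategory.fst (projectiveSpace (d + 1) k) T).left (genericFibreι (d + 1) T βP))
      rw [fst_genericFibreι_apply, mem_asHomogeneousIdeal_projMap_iff]
      exact mem_asHomogeneousIdeal_pt_pointOfVec hβ0 zero_lt_one ((hLphom j).map _) (hβL j)
    have heq : i.left.base yP = fstP.base (genericFibreι (d + 1) T βP) :=
      eq_of_specializes_of_height_eq hsp (hp2.trans hyP2.symm) (by rw [hyP2]; exact WithTop.coe_lt_top _)
    refine ⟨AlgebraicCycle.mapCoeff fstP height height (genericFibreι (d + 1) T βP), ?_⟩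
    change cycleRestrictClosed i.left (AlgebraicCycle.mapCoeff fstP height height (genericFibreι (d + 1) T βP) •
      primeCycle (fstP.base (genericFibreι (d + 1) T βP))) = _
    rw [← heq, ← algebraicCycleMap_primeCycle i.left yP, ← cycleRestrictClosedHom_apply, map_nsmul,
      cycleRestrictClosedHom_apply, cycleRestrictClosed_map]

/-- **Mboro's tangent-line relation over a surface base, on the cubic hypersurface** (the lines of
the proof of Thm. 1.3 — tangent at `x` with one residual point — treated as in the proof of Thm. 1.2,
Case 2: "`(f_* ℙ_Σ̃)|_X = dΣ + R`" with "`d H_X · f_*(1) = i_X^* i_{X,*} f_*(1) ∈ ℤ · H_X^{d-2}`").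
Let `X = V₊(F) ⊆ ℙᵈ⁺¹_k` be an integral cubic hypersurface over an algebraically closed field,
`d ≥ 14`, `M = V₊(ℓ₁, …, ℓ_c) ⊄ X` a `3`-plane (`2 + c = d`) whose hyperplanes do not contain `X`,
`T` an integral proper surface base with a morphism `f : T → ℙ^𝐍` whose generic point is the
Plücker point of the `k(T)`-line `[x][y]`, tangent to `V₊(F)` at `[x]` with residual point `[y]`
(`F(s x + t y) = c s t²`, `c ≠ 0`). Then there are `a ∈ ℤ` and a cycle `Pl` on `X` supported on
plane points with
`2 · (pr₁₊[closure ι([x])])|_X + (pr₁₊[closure ι([y])])|_X - a · [X ∩ M] - Pl ∈ Rat₂(X)`.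
[cite: Mboro2018, proofs of Thm. 1.2 (Case 2, p. 7) and Thm. 1.3 (p. 8) (arXiv:1701.04488)] [cite: Fulton1998, Prop. 2.3 (c), Cor. 2.4.1] [cite: TianZong2014, Prop. 7.2 (proof)] -/
theorem exists_relation_of_tangent_line_over_T (hd : 14 ≤ d)
    (hF : F ∈ grading (Fin (d + 1 + 1)) k 3) (hprime : Prime F)
    (hrange : Set.range i.left.base =
      ProjectiveSpectrum.zeroLocus (homogeneousSubmodule (Fin (d + 1 + 1)) k) {F})
    (hT2 : height (genericPoint T.left) = 2)
    {c : ℕ} (hdim : 2 + c = d) (ℓ : Fin c → MvPolynomial (Fin (d + 1 + 1)) k)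
    (hℓ : ∀ j, ℓ j ∈ grading (Fin (d + 1 + 1)) k 1) (hlin : LinearIndependent k ℓ)
    (hav : ∀ j, (formDivisor (ℓ j) (hℓ j) (hlin.ne_zero j)).Avoids (i.left.base (genericPoint ↥X.left)))
    (w : ↥(projectiveSpace (d + 1) k).left)
    (hw : (ProjectiveSpectrum.asHomogeneousIdeal
      (𝒜 := homogeneousSubmodule (Fin (d + 1 + 1)) k) w).toIdeal = Ideal.span (Set.range ℓ))
    (hFw : F ∉ ProjectiveSpectrum.asHomogeneousIdeal (𝒜 := homogeneousSubmodule (Fin (d + 1 + 1)) k) w)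
    (f : T ⟶ projectiveSpace ((d + 1) * (d + 1) + 2 * (d + 1)) k)
    (x y : Fin (d + 1 + 1) → T.left.functionField)
    (hxy : LinearIndependent T.left.functionField ![x, y])
    {c₀ : T.left.functionField} (hc₀ : c₀ ≠ 0)
    (htan : ∀ s t : T.left.functionField,
      eval (s • x + t • y) (MvPolynomial.map (algebraMap k T.left.functionField) F) = c₀ * s * t ^ 2)
    (P : Fin ((d + 1) * (d + 1) + 2 * (d + 1) + 1) → T.left.functionField)
    (hPw : ∀ a b, P (plIdx (d + 1) (a, b)) = wedge x y a b) (hP0 : P ≠ 0)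
    (hP : qgen T ≫ f.left = (pointOfVec k P hP0).left) :
    ∃ (a : ℤ) (Pl : AlgebraicCycle X.left ℤ), (∀ y', Pl y' ≠ 0 → IsLinearSubspacePoint 2 (d + 1) i y') ∧
      2 • restrictMapFst T X i (primeCycle (genericFibreι (d + 1) T
          (pointOfVec T.left.functionField x (by simpa using hxy.ne_zero 0)).pt)) +
        restrictMapFst T X i (primeCycle (genericFibreι (d + 1) T
          (pointOfVec T.left.functionField y (by simpa using hxy.ne_zero 1)).pt)) -
        a • CartierDivisor.iterInter c
          (fun j => (formDivisor (ℓ j) (hℓ j) (hlin.ne_zero j)).pullbackAvoiding i.left (hav j))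
          (primeCycle (genericPoint ↥X.left)) - Pl ∈ ratTrivial X.left 2 := by
  classical
  haveI := infinite_functionField (k := k) T
  have hN : 1 ≤ d + 1 := by omega
  have hF0 : F ≠ 0 := hprime.ne_zero
  have hF3 : F.IsHomogeneous 3 := (mem_homogeneousSubmodule 3 F).1 hF
  -- the line forms
  obtain ⟨μ, hμli, hμhom, hμv, hμideal⟩ := exists_lineForms ![x, y] hxy hN
  have hμx : ∀ l, eval x (μ l) = 0 := fun l => hμv l 0
  have hμy : ∀ l, eval y (μ l) = 0 := fun l => hμv l 1
  have hμideal' : ∀ G : MvPolynomial (Fin (d + 1 + 1)) T.left.functionField,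
      (∀ s t : T.left.functionField, eval (s • x + t • y) G = 0) → G ∈ Ideal.span (Set.range μ) :=
    fun G hG => hμideal G fun s t => hG s t
  let R := restrictMapFst T X i
  -- (1) `pr₁^*V₊(F) · [closure ι(l)] = 2 [closure ι([x])] + [closure ι([y])] + V`
  obtain ⟨V, hZ, -, hVsupp⟩ := exists_primeInter_pullbackFormDivisor_line_eq_of_tangent (B := T) hN hT2 hxy
    hF hF0 hc₀ htan hμli hμhom hμx hμy hμideal'
  -- (2) the vertical part pushes forward to planes
  obtain ⟨Pl, hPl, hRV⟩ := exists_planes_restrictMapFst_of_vertical T X i hd hF3 hrange hT2 f x y P hPw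
    hP0 hP hμli hμhom hμideal' V hVsupp
  -- (3) `(pr₁₊(pr₁^*V₊(F) · [closure ι(l)]))|_X ≡ a · [X ∩ M]`
  have hlam1 : height (linearSubspacePoint μ hμli hμhom (Nat.sub_le (d + 1) 1)) = 1 :=
    height_linearSubspacePoint_of_line hN μ hμli hμhom
  have hιlam : height (genericFibreι (d + 1) T (linearSubspacePoint μ hμli hμhom (Nat.sub_le (d + 1) 1))) =
      (2 : ℕ) + 1 := by
    rw [height_genericFibreι_apply (d + 1) T hT2, hlam1]
  obtain ⟨a, ha⟩ := exists_restrictMapFst_primeInter_sub_mem T X i hF hprime hrange hdim ℓ hℓ hlin hav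
    w hw hFw hιlam
  -- (4) assemble (with the plane cycle `-Pl`)
  refine ⟨a, -Pl, fun y' hy' => hPl y' (by
    rwa [Function.locallyFinsuppWithin.coe_neg, Pi.neg_apply, neg_ne_zero] at hy'), ?_⟩
  have hRZ : R ((pullbackFormDivisor (B := T) hF hF0).primeInter (X := (projectiveSpace (d + 1) k) ⊗ T)
      (genericFibreι (d + 1) T (linearSubspacePoint μ hμli hμhom (Nat.sub_le (d + 1) 1)))) =
      2 • R (primeCycle (genericFibreι (d + 1) T
        (pointOfVec T.left.functionField x (by simpa using hxy.ne_zero 0)).pt)) +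
      R (primeCycle (genericFibreι (d + 1) T
        (pointOfVec T.left.functionField y (by simpa using hxy.ne_zero 1)).pt)) + R V := by
    rw [hZ, map_add, map_add, map_nsmul]
  have key : 2 • R (primeCycle (genericFibreι (d + 1) T
        (pointOfVec T.left.functionField x (by simpa using hxy.ne_zero 0)).pt)) +
      R (primeCycle (genericFibreι (d + 1) T
        (pointOfVec T.left.functionField y (by simpa using hxy.ne_zero 1)).pt)) -
      a • CartierDivisor.iterInter c
        (fun j => (formDivisor (ℓ j) (hℓ j) (hlin.ne_zero j)).pullbackAvoiding i.left (hav j))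
        (primeCycle (genericPoint ↥X.left)) - -Pl =
      (R ((pullbackFormDivisor (B := T) hF hF0).primeInter (X := (projectiveSpace (d + 1) k) ⊗ T)
          (genericFibreι (d + 1) T (linearSubspacePoint μ hμli hμhom (Nat.sub_le (d + 1) 1)))) -
        a • CartierDivisor.iterInter c
          (fun j => (formDivisor (ℓ j) (hℓ j) (hlin.ne_zero j)).pullbackAvoiding i.left (hav j))
          (primeCycle (genericPoint ↥X.left))) - (R V - Pl) := by
    rw [hRZ]; abel
  rw [key]
  exact AddSubgroup.sub_mem _ ha hRV

omit [IsIntegral X.left] in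
/-- **The two sections of a family of lines on `X` over a surface base differ by planes.** Same
setting, but with the `k(T)`-line `[x][y]` contained in `X_{k(T)}` (`F ≡ 0` on `span(x, y)`): there
is a cycle `Pl` on `X` supported on plane points with
`(pr₁₊[closure ι([x])])|_X - (pr₁₊[closure ι([y])])|_X - Pl ∈ Rat₂(X)` — the relation
`[x] - [y] = div` on the line spread out over `T` (`exists_relation_of_line_over_T`, Tian–Zong's
family technique; Mboro, proof of Thm. 1.2, Case 1: "`Σ = H_X · f_*(1) + P_*(p_* σ̃_*(D))`").
[cite: Mboro2018, proof of Thm. 1.2, Case 1 (arXiv:1701.04488, p. 7)] [cite: TianZong2014, Prop. 7.2 (proof)] -/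
theorem exists_relation_of_line_in_X_over_T' (hd : 14 ≤ d)
    (hF3 : F.IsHomogeneous 3)
    (hrange : Set.range i.left.base =
      ProjectiveSpectrum.zeroLocus (homogeneousSubmodule (Fin (d + 1 + 1)) k) {F})
    (hT2 : height (genericPoint T.left) = 2)
    (f : T ⟶ projectiveSpace ((d + 1) * (d + 1) + 2 * (d + 1)) k)
    (x y : Fin (d + 1 + 1) → T.left.functionField)
    (hxy : LinearIndependent T.left.functionField ![x, y])
    (hFline : ∀ s t : T.left.functionField,
      eval (s • x + t • y) (MvPolynomial.map (algebraMap k T.left.functionField) F) = 0)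
    (P : Fin ((d + 1) * (d + 1) + 2 * (d + 1) + 1) → T.left.functionField)
    (hPw : ∀ a b, P (plIdx (d + 1) (a, b)) = wedge x y a b) (hP0 : P ≠ 0)
    (hP : qgen T ≫ f.left = (pointOfVec k P hP0).left) :
    ∃ Pl : AlgebraicCycle X.left ℤ, (∀ y', Pl y' ≠ 0 → IsLinearSubspacePoint 2 (d + 1) i y') ∧
      restrictMapFst T X i (primeCycle (genericFibreι (d + 1) T
          (pointOfVec T.left.functionField x (by simpa using hxy.ne_zero 0)).pt)) -
        restrictMapFst T X i (primeCycle (genericFibreι (d + 1) T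
          (pointOfVec T.left.functionField y (by simpa using hxy.ne_zero 1)).pt)) - Pl ∈
        ratTrivial X.left 2 := by
  classical
  haveI := infinite_functionField (k := k) T
  haveI : IsProper (projectiveSpace (d + 1) k).hom := isProper_projectiveSpace (d + 1) k
  haveI : IsProper X.hom := by rw [← Over.w i]; infer_instance
  haveI : LocallyOfFiniteType (X ⊗ T).hom :=
    inferInstanceAs (LocallyOfFiniteType (pullback.fst X.hom T.hom ≫ X.hom))
  let ι := genericFibreι (d + 1) T
  let R := restrictMapFst T X i
  let M : AlgebraicCycle (X ⊗ T).left ℤ → AlgebraicCycle X.left ℤ :=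
    AlgebraicCycle.map (CartesianMonoidalCategory.fst X T).left height height
  obtain ⟨c', hc', uX, huX, Pl₁, hPl₁, hE⟩ := exists_relation_of_line_over_T T X i hd hF3 hrange hT2 f
    ![x, y] hxy hFline P hPw hP0 hP
  have hMc' : M c' ∈ ratTrivial X.left 2 :=
    map_mem_ratTrivial_holds (d := 2) (CartesianMonoidalCategory.fst X T) hc'
  have hjι : ∀ q, (i ▷ T).left.base ((ιX T X).base q) = ι ((iK (d + 1) T X i).base q) := by
    intro q
    change ((ιX T X ≫ (i ▷ T).left).base q) = ((iK (d + 1) T X i ≫ genericFibreι (d + 1) T).base q)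
    rw [iK_genericFibreι]
  have hMu : ∀ a, M (primeCycle ((ιX T X).base (uX a))) =
      R (primeCycle (ι (pointOfVec T.left.functionField (![x, y] a) (hxy.ne_zero a)).pt)) := by
    intro a
    rw [← huX a, ← hjι]
    exact (restrictMapFst_primeCycle_whiskerRight T X i _).symm
  refine ⟨-Pl₁, fun y' hy' => hPl₁ y' (by
    rwa [Function.locallyFinsuppWithin.coe_neg, Pi.neg_apply, neg_ne_zero] at hy'), ?_⟩
  have h0 : M (primeCycle ((ιX T X).base (uX 0))) =
      R (primeCycle (ι (pointOfVec T.left.functionField x (by simpa using hxy.ne_zero 0)).pt)) := hMu 0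
  have h1 : M (primeCycle ((ιX T X).base (uX 1))) =
      R (primeCycle (ι (pointOfVec T.left.functionField y (by simpa using hxy.ne_zero 1)).pt)) := hMu 1
  have key : R (primeCycle (ι (pointOfVec T.left.functionField x (by simpa using hxy.ne_zero 0)).pt)) -
      R (primeCycle (ι (pointOfVec T.left.functionField y (by simpa using hxy.ne_zero 1)).pt)) - -Pl₁ =
      M c' - (M c' - (M (primeCycle ((ιX T X).base (uX 0))) - M (primeCycle ((ιX T X).base (uX 1)))) - Pl₁) := by
    rw [h0, h1]; abel
  rw [key]
  exact AddSubgroup.sub_mem _ hMc' hE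

end OverT

/-! ### The relation `2 [S] - a · [X ∩ M] - (planes) ∈ Rat₂(X)` -/

section Main

variable {k : Type u} [Field k] [IsAlgClosed k] {d : ℕ} (X : SchemeOver k) [IsIntegral X.left]
  [LocallyOfFiniteType X.hom] (i : X ⟶ projectiveSpace (d + 1) k) [IsClosedImmersion i.left]
  {F : MvPolynomial (Fin (d + 1 + 1)) k}

/-- **The tangent-line relation on the cubic hypersurface, core statement.** Let `X = V₊(F) ⊆ ℙᵈ⁺¹_k`
be an integral cubic hypersurface over an algebraically closed field, `d ≥ 14`, `M ⊄ X` a `3`-plane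
as in `exists_relation_of_tangent_line_over_T`, and `P = V₊(L) ⊆ X` a plane (`L` its `d - 1`
equations). Let the surface `S = closure {z}` be given by a preimmersed `K₀`-point `a₀ = [p₀]` of
`X` (`trdeg_k K₀ = 2`) and let `β₀ ∈ K₀ᵈ⁺²` be independent of `p₀` with `L_j(β₀) = 0` (`[β₀]` is a
`K₀`-point of `P`) such that the line `[p₀][β₀]` is tangent to `X` at `[p₀]` with residual point
`[β₀]`, or lies on `X` (`F(s p₀ + t β₀) = c₀ s t²`). Then there are `a ∈ ℤ` and a cycle `Pl` on
`X` supported on plane points with `2 [S] - a · [X ∩ M] - Pl ∈ Rat₂(X)`.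
[cite: Mboro2018, proofs of Thm. 1.2 (p. 7) and Thm. 1.3 (p. 8) (arXiv:1701.04488)] -/
theorem exists_two_smul_primeCycle_sub_mem_of_tangent (hd : 14 ≤ d)
    (hF : F ∈ grading (Fin (d + 1 + 1)) k 3) (hprime : Prime F)
    (hrange : Set.range i.left.base =
      ProjectiveSpectrum.zeroLocus (homogeneousSubmodule (Fin (d + 1 + 1)) k) {F})
    {c : ℕ} (hdim : 2 + c = d) (ℓ : Fin c → MvPolynomial (Fin (d + 1 + 1)) k)
    (hℓ : ∀ j, ℓ j ∈ grading (Fin (d + 1 + 1)) k 1) (hlin : LinearIndependent k ℓ)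
    (hav : ∀ j, (formDivisor (ℓ j) (hℓ j) (hlin.ne_zero j)).Avoids (i.left.base (genericPoint ↥X.left)))
    (w : ↥(projectiveSpace (d + 1) k).left)
    (hw : (ProjectiveSpectrum.asHomogeneousIdeal
      (𝒜 := homogeneousSubmodule (Fin (d + 1 + 1)) k) w).toIdeal = Ideal.span (Set.range ℓ))
    (hFw : F ∉ ProjectiveSpectrum.asHomogeneousIdeal (𝒜 := homogeneousSubmodule (Fin (d + 1 + 1)) k) w)
    {t : ℕ} {Lp : Fin t → MvPolynomial (Fin (d + 1 + 1)) k} (hLpli : LinearIndependent k Lp)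
    (hLphom : ∀ j, (Lp j).IsHomogeneous 1) (ht : t + 3 = d + 1 + 1) (yP : ↥X.left)
    (hyP : (ProjectiveSpectrum.asHomogeneousIdeal
      (𝒜 := homogeneousSubmodule (Fin (d + 1 + 1)) k) (i.left.base yP)).toIdeal = Ideal.span (Set.range Lp))
    {K₀ : Type u} [Field K₀] [Algebra k K₀] (htr : Algebra.trdeg k K₀ = 2)
    (a₀ : AlgPoints X K₀) [IsPreimmersion a₀.left] {z : ↥X.left} (ha₀z : a₀.pt = z)
    (p₀ β₀ : Fin (d + 1 + 1) → K₀) (hpβ : LinearIndependent K₀ ![p₀, β₀]) (hp₀0 : p₀ ≠ 0)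
    (hPp : AlgPoints.map i a₀ = pointOfVec k p₀ hp₀0)
    (hβL : ∀ j, eval β₀ (MvPolynomial.map (algebraMap k K₀) (Lp j)) = 0)
    (c₀ : K₀) (htan₀ : ∀ s t : K₀, eval (s • p₀ + t • β₀) (MvPolynomial.map (algebraMap k K₀) F) =
      c₀ * s * t ^ 2) :
    ∃ (a : ℤ) (Pl : AlgebraicCycle X.left ℤ), (∀ y, Pl y ≠ 0 → IsLinearSubspacePoint 2 (d + 1) i y) ∧
      2 • primeCycle z - a • CartierDivisor.iterInter c
          (fun j => (formDivisor (ℓ j) (hℓ j) (hlin.ne_zero j)).pullbackAvoiding i.left (hav j))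
          (primeCycle (genericPoint ↥X.left)) - Pl ∈ ratTrivial X.left 2 := by
  classical
  haveI : IsProper (projectiveSpace (d + 1) k).hom := isProper_projectiveSpace (d + 1) k
  haveI : IsProper X.hom := by rw [← Over.w i]; infer_instance
  have hF0 : F ≠ 0 := hprime.ne_zero
  have hF3 : F.IsHomogeneous 3 := (mem_homogeneousSubmodule 3 F).1 hF
  have hβ₀0 : β₀ ≠ 0 := by simpa using hpβ.ne_zero 1
  have hyPl : IsLinearSubspacePoint 2 (d + 1) i yP := by
    have h := Hypersurface.isLinearSubspacePoint_of_toIdeal_base_eq_span (i := i) Lp hLpli hLphom (by omega) hyP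
    rwa [show d + 1 - t = 2 by omega] at h
  -- the Plücker space and the Plücker vector of the line `[p₀][β₀]`
  let NN : ℕ := (d + 1) * (d + 1) + 2 * (d + 1)
  let PN : SchemeOver k := projectiveSpace NN k
  haveI : IsProper PN.hom := isProper_projectiveSpace NN k
  let w₁ : Fin (NN + 1) → K₀ :=
    fun c => wedge p₀ β₀ ((plIdx (d + 1)).symm c).1 ((plIdx (d + 1)).symm c).2
  have hw₁ : w₁ ≠ 0 := by
    intro h0
    apply (wedge_ne_zero_iff p₀ β₀).2 hpβ
    funext a b
    have := congr_fun h0 (plIdx (d + 1) (a, b))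
    simpa [w₁] using this
  -- the ambient `Y = X × ℙ^𝐍` and the `K₀`-point `Q = (a₀, [w₁])`
  let Y : SchemeOver k := X ⊗ PN
  let Q : AlgPoints Y (K₀) := AlgPoints.prodEquiv.symm (a₀, pointOfVec k w₁ hw₁)
  let prX : Y ⟶ X := CartesianMonoidalCategory.fst _ _
  let pr₁ : Y ⟶ PN := CartesianMonoidalCategory.snd _ _
  have hQX : Q ≫ prX = a₀ := by
    change CartesianMonoidalCategory.lift a₀ (pointOfVec k w₁ hw₁) ≫ CartesianMonoidalCategory.fst _ _ = a₀
    rw [CartesianMonoidalCategory.lift_fst]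
  have hQ₁ : Q ≫ pr₁ = pointOfVec k w₁ hw₁ := by
    change CartesianMonoidalCategory.lift a₀ (pointOfVec k w₁ hw₁) ≫ CartesianMonoidalCategory.snd _ _ = _
    rw [CartesianMonoidalCategory.lift_snd]
  -- `𝒪_{Y,Q} → K₀` is onto (through `a₀`, a preimmersion)
  have surj_of_pre : ∀ {Z : Scheme.{u}} (g : Spec (CommRingCat.of (K₀)) ⟶ Z)
      [IsPreimmersion g], Function.Surjective (Scheme.stalkClosedPointTo g) := by
    intro Z g _
    change Function.Surjective (g.stalkMap _ ≫ (stalkClosedPointIso (CommRingCat.of (K₀))).hom)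
    intro y
    obtain ⟨x, hx⟩ := g.stalkMap_surjective _
      ((stalkClosedPointIso (CommRingCat.of (K₀))).inv y)
    refine ⟨x, ?_⟩
    change (stalkClosedPointIso (CommRingCat.of (K₀))).hom (g.stalkMap _ x) = y
    rw [hx, ← CategoryTheory.comp_apply, Iso.inv_hom_id]; rfl
  have hQX' : Q.left ≫ prX.left = a₀.left := congrArg CommaMorphism.left hQX
  haveI hpreQ : IsPreimmersion (Q.left ≫ prX.left) := hQX'.symm ▸ (inferInstance : IsPreimmersion a₀.left)
  have hQ : Function.Surjective (Scheme.stalkClosedPointTo Q.left) := by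
    have h : Scheme.stalkClosedPointTo (Q.left ≫ prX.left) =
        prX.left.stalkMap _ ≫ Scheme.stalkClosedPointTo Q.left := Scheme.stalkClosedPointTo_comp _ _
    have hs : Function.Surjective (Scheme.stalkClosedPointTo (Q.left ≫ prX.left)) :=
      @surj_of_pre _ (Q.left ≫ prX.left) hpreQ
    rw [h] at hs
    exact Function.Surjective.of_comp hs
  -- the base `T`
  obtain ⟨τ, e, hτ1, hτk, hτη, hgen, hek⟩ := exists_ringEquiv_functionField_of_surjective Y Q hQ
  let T : SchemeOver k := Over.mk ((ClosedSubvariety.ofPoint Y.left Q.pt).ι ≫ Y.hom)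
  haveI : IsIntegral T.left := inferInstanceAs (IsIntegral (ClosedSubvariety.ofPoint Y.left Q.pt).carrier)
  haveI : IsProper T.hom := isProper_ofPoint Y Q
  have hT2 : height (genericPoint T.left) = 2 := by
    have h := height_genericPoint_ofPoint_eq_toENat_trdeg Y Q hQ
    rw [htr] at h
    exact h.trans (by simp)
  let Tι : T ⟶ Y := Over.homMk (ClosedSubvariety.ofPoint Y.left Q.pt).ι rfl
  let f₁ : T ⟶ PN := Tι ≫ pr₁
  obtain ⟨h0₁, hP₁⟩ := qgen_comp_eq_pointOfVec Y Q hτ1 hgen hek pr₁ hw₁ hQ₁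
  -- the coefficient field `K = k(T) ≅ K₀`
  let φ : K₀ →+* T.left.functionField := e.symm.toRingHom
  have hφ : ∀ c : k, φ (algebraMap k _ c) = algebraMap k T.left.functionField c := fun c => by
    change e.symm (algebraMap k _ c) = _
    rw [← hek c, RingEquiv.symm_apply_apply]
  let φa : K₀ →ₐ[k] T.left.functionField := { φ with commutes' := hφ }
  letI algφ : Algebra (K₀) T.left.functionField := φ.toAlgebra
  let x : Fin (d + 1 + 1) → T.left.functionField := ⇑φa ∘ p₀
  let y : Fin (d + 1 + 1) → T.left.functionField := ⇑φa ∘ β₀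
  have hmat : (![x, y] : Fin 2 → Fin (d + 1 + 1) → T.left.functionField) = fun a => ⇑φa ∘ ![p₀, β₀] a := by
    ext a j; fin_cases a <;> rfl
  have hxy : LinearIndependent T.left.functionField ![x, y] := by
    rw [hmat]
    exact (linearIndependent_algebraMap_comp_iff (R := K₀)
      (S := T.left.functionField) (v := ![p₀, β₀])).2 hpβ
  have hx0 : x ≠ 0 := by simpa using hxy.ne_zero 0
  have hy0 : y ≠ 0 := by simpa using hxy.ne_zero 1
  -- the tangency identity over `k(T)`
  have hevalT : ∀ (u : Fin (d + 1 + 1) → K₀) (G : MvPolynomial (Fin (d + 1 + 1)) k),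
      eval (⇑φa ∘ u) (MvPolynomial.map (algebraMap k T.left.functionField) G) =
        φ (eval u (MvPolynomial.map (algebraMap k (K₀)) G)) :=
    fun u G => eval_comp_map_eq φ hφ u G
  have hfun : ∀ s' t' : K₀,
      (e.symm s' • x + e.symm t' • y : Fin (d + 1 + 1) → T.left.functionField) =
        ⇑φa ∘ (s' • p₀ + t' • β₀) := by
    intro s' t'
    funext j
    simp only [x, y, Pi.add_apply, Pi.smul_apply, smul_eq_mul, map_add, map_mul, Function.comp_apply]
    rfl
  have htanT : ∀ s t : T.left.functionField,
      eval (s • x + t • y) (MvPolynomial.map (algebraMap k T.left.functionField) F) =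
        φ c₀ * s * t ^ 2 := by
    intro s t
    obtain ⟨s', rfl⟩ := e.symm.surjective s
    obtain ⟨t', rfl⟩ := e.symm.surjective t
    rw [hfun, hevalT, htan₀ s' t', map_mul, map_mul, map_pow]
    rfl
  have hβLT : ∀ j, eval y (MvPolynomial.map (algebraMap k T.left.functionField) (Lp j)) = 0 := by
    intro j
    change eval (⇑φa ∘ β₀) _ = 0
    rw [hevalT, hβL j, map_zero]
  -- Plücker data of the line map
  have hPw : ∀ a b : Fin (d + 1 + 1), (fun j => e.symm (w₁ j)) (plIdx (d + 1) (a, b)) = wedge x y a b := by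
    intro a b
    simp only [w₁, Equiv.symm_apply_apply]
    exact (congr_fun (congr_fun (wedge_map φ p₀ β₀) a) b).symm
  -- the `[β₀]`-section pushes forward to a multiple of the plane
  obtain ⟨m, hm⟩ := exists_restrictMapFst_primeCycle_genericFibreι_eq_smul T X i hT2 hy0 hLpli hLphom ht yP
    hyP hβLT
  -- the relation over `T`, in both cases
  have hrel : ∃ (a : ℤ) (Pl : AlgebraicCycle X.left ℤ),
      (∀ y', Pl y' ≠ 0 → IsLinearSubspacePoint 2 (d + 1) i y') ∧
      2 • restrictMapFst T X i (primeCycle (genericFibreι (d + 1) T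
          (pointOfVec T.left.functionField x hx0).pt)) -
        a • CartierDivisor.iterInter c
          (fun j => (formDivisor (ℓ j) (hℓ j) (hlin.ne_zero j)).pullbackAvoiding i.left (hav j))
          (primeCycle (genericPoint ↥X.left)) - Pl ∈ ratTrivial X.left 2 := by
    by_cases hc₀ : c₀ = 0
    · -- the line lies on `X`
      have hFlineT : ∀ s t : T.left.functionField,
          eval (s • x + t • y) (MvPolynomial.map (algebraMap k T.left.functionField) F) = 0 := by
        intro s t
        rw [htanT, hc₀, map_zero, zero_mul, zero_mul]
      obtain ⟨Pl, hPl, hE⟩ := exists_relation_of_line_in_X_over_T' T X i hd hF3 hrange hT2 f₁ x y hxy hFlineT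
        _ hPw h0₁ hP₁
      refine ⟨0, 2 • Pl + 2 • (m : ℤ) • primeCycle yP, fun y' hy' => ?_, ?_⟩
      · rw [Function.locallyFinsuppWithin.coe_add, Pi.add_apply] at hy'
        by_cases h1 : Pl y' = 0
        · have h2 : (2 • (m : ℤ) • primeCycle yP) y' ≠ 0 := by
            intro h2
            apply hy'
            rw [Function.locallyFinsuppWithin.coe_nsmul, Pi.smul_apply, h1, nsmul_zero, zero_add, h2]
          have hyy : y' = yP := by
            by_contra hne
            apply h2
            rw [Function.locallyFinsuppWithin.coe_nsmul, Pi.smul_apply, Function.locallyFinsuppWithin.coe_zsmul,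
              Pi.smul_apply, primeCycle_apply_of_ne hne, smul_zero, nsmul_zero]
          rw [hyy]; exact hyPl
        · exact hPl y' h1
      · rw [hm] at hE
        have key : 2 • restrictMapFst T X i (primeCycle (genericFibreι (d + 1) T
            (pointOfVec T.left.functionField x hx0).pt)) -
            (0 : ℤ) • CartierDivisor.iterInter c
              (fun j => (formDivisor (ℓ j) (hℓ j) (hlin.ne_zero j)).pullbackAvoiding i.left (hav j))
              (primeCycle (genericPoint ↥X.left)) - (2 • Pl + 2 • (m : ℤ) • primeCycle yP) =
            2 • (restrictMapFst T X i (primeCycle (genericFibreι (d + 1) T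
              (pointOfVec T.left.functionField x hx0).pt)) - m • primeCycle yP - Pl) := by
          rw [zero_smul, sub_zero, ← natCast_zsmul _ m]
          abel
        rw [key]
        exact AddSubgroup.nsmul_mem _ hE 2
    · -- the tangent line
      have hc₀T : φ c₀ ≠ 0 := (map_ne_zero_iff φ φ.injective).2 hc₀
      obtain ⟨a, Pl, hPl, hE⟩ := exists_relation_of_tangent_line_over_T T X i hd hF hprime hrange hT2 hdim ℓ hℓ
        hlin hav w hw hFw f₁ x y hxy hc₀T htanT _ hPw h0₁ hP₁
      refine ⟨a, Pl - (m : ℤ) • primeCycle yP, fun y' hy' => ?_, ?_⟩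
      · rw [Function.locallyFinsuppWithin.coe_sub, Pi.sub_apply] at hy'
        by_cases h1 : Pl y' = 0
        · have h2 : ((m : ℤ) • primeCycle yP) y' ≠ 0 := by
            intro h2; apply hy'; rw [h1, h2, sub_zero]
          have hyy : y' = yP := by
            by_contra hne
            apply h2
            rw [Function.locallyFinsuppWithin.coe_zsmul, Pi.smul_apply, primeCycle_apply_of_ne hne, smul_zero]
          rw [hyy]; exact hyPl
        · exact hPl y' h1
      · rw [hm] at hE
        have key : 2 • restrictMapFst T X i (primeCycle (genericFibreι (d + 1) T
            (pointOfVec T.left.functionField x hx0).pt)) -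
            a • CartierDivisor.iterInter c
              (fun j => (formDivisor (ℓ j) (hℓ j) (hlin.ne_zero j)).pullbackAvoiding i.left (hav j))
              (primeCycle (genericPoint ↥X.left)) - (Pl - (m : ℤ) • primeCycle yP) =
            2 • restrictMapFst T X i (primeCycle (genericFibreι (d + 1) T
              (pointOfVec T.left.functionField x hx0).pt)) + m • primeCycle yP -
            a • CartierDivisor.iterInter c
              (fun j => (formDivisor (ℓ j) (hℓ j) (hlin.ne_zero j)).pullbackAvoiding i.left (hav j))
              (primeCycle (genericPoint ↥X.left)) - Pl := by
          rw [← natCast_zsmul _ m]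
          abel
        rw [key]
        exact hE
  obtain ⟨a, Pl, hPl, hrelT⟩ := hrel
  -- identification of the `p₀`-section: `(pr₁₊[closure ι([x])])|_X = [S]`
  have hinjK : Function.Injective (iK (d + 1) T X i).base := (iK (d + 1) T X i).isClosedEmbedding.injective
  have hcomp : CommRingCat.ofHom e.toRingHom ≫ CommRingCat.ofHom e.symm.toRingHom = 𝟙 _ := by
    ext b; exact e.symm_apply_apply b
  have h1 : Spec.map (CommRingCat.ofHom e.symm.toRingHom) ≫ Spec.map (CommRingCat.ofHom e.toRingHom) = 𝟙 _ := by
    rw [← Spec.map_comp, hcomp, Spec.map_id]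
  have hqgen : Spec.map (CommRingCat.ofHom φ) ≫ τ = qgen T := by
    rw [← hgen]
    exact (reassoc_of% h1) _
  have hcomp' : CommRingCat.ofHom φ ≫ CommRingCat.ofHom e.toRingHom = 𝟙 _ := by
    ext b; exact e.apply_symm_apply b
  have h2 : Spec.map (CommRingCat.ofHom e.toRingHom) ≫ Spec.map (CommRingCat.ofHom φ) = 𝟙 _ := by
    rw [← Spec.map_comp, hcomp', Spec.map_id]
  haveI : IsIso (Spec.map (CommRingCat.ofHom φ)) := ⟨⟨Spec.map (CommRingCat.ofHom e.toRingHom), h1, h2⟩⟩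
  haveI hpreφ : IsPreimmersion (Spec.map (CommRingCat.ofHom φ)) := inferInstance
  -- LINK: a `K`-point `a'` of `X` with `a' ≫ i = Spec φ ≫ [u]` lies under `[φ ∘ u] ∈ ℙ_K(K)`
  have link : ∀ (a' : Spec T.left.functionField ⟶ X.left) (ha' : a' ≫ X.hom = qgen T ≫ T.hom)
      (u : Fin (d + 1 + 1) → K₀) (hu0 : u ≠ 0),
      a' ≫ i.left = Spec.map (CommRingCat.ofHom φa.toRingHom) ≫ (pointOfVec k u hu0).left →
      (pointOfVec T.left.functionField (⇑φa ∘ u) (ProjectiveSpace.comp_ne_zero φa hu0)).pt =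
        uPt (d + 1) T X i a' ha' := by
    intro a' ha' u hu0 hai
    suffices hmor : (pointOfVec T.left.functionField (⇑φa ∘ u) (ProjectiveSpace.comp_ne_zero φa hu0)).left =
        sPt (d + 1) T X i a' ha' by
      change (pointOfVec T.left.functionField (⇑φa ∘ u) (ProjectiveSpace.comp_ne_zero φa hu0)).left.base
        (IsLocalRing.closedPoint _) = (sPt (d + 1) T X i a' ha').base (IsLocalRing.closedPoint _)
      rw [hmor]
      rfl
    have hsPt : sPt (d + 1) T X i a' ha' ≫ Proj.map (mapGraded k T.left.functionField (Fin (d + 1 + 1)))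
        (irrelevant_le_map k T.left.functionField (Fin (d + 1 + 1))) = a' ≫ i.left := by
      have e1 : iK (d + 1) T X i ≫ genericFibreι (d + 1) T ≫
          (CartesianMonoidalCategory.fst (projectiveSpace (d + 1) k) T).left =
            ιX T X ≫ (CartesianMonoidalCategory.fst X T).left ≫ i.left := by
        rw [← Category.assoc, iK_genericFibreι, Category.assoc, whiskerRight_left_fst]
      change (tPt T X a' ha' ≫ iK (d + 1) T X i) ≫ _ = _
      refine (congrArg ((tPt T X a' ha' ≫ iK (d + 1) T X i) ≫ ·) (genericFibreι_fst (d + 1) T).symm).trans ?_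
      refine (Category.assoc _ _ _).trans ?_
      refine (congrArg (tPt T X a' ha' ≫ ·) e1).trans ?_
      refine (Category.assoc _ _ _).symm.trans ?_
      refine (congrArg (· ≫ ((CartesianMonoidalCategory.fst X T).left ≫ i.left)) (tPt_ιX T X a' ha')).trans ?_
      refine (Category.assoc _ _ _).symm.trans ?_
      exact congrArg (· ≫ i.left) (liftPt_fst T X a' ha')
    refine (isPullback_projMap' k T.left.functionField (n := d + 1)).hom_ext ?_ ?_
    · exact ((pointOfVec_left_comp_projMap (k := k) (⇑φa ∘ u) (ProjectiveSpace.comp_ne_zero φa hu0)).trans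
        ((pointOfVec_left_comp_algHom φa u hu0).trans (hai.symm.trans hsPt.symm)))
    · have hs1 : (pointOfVec T.left.functionField (⇑φa ∘ u) (ProjectiveSpace.comp_ne_zero φa hu0)).left ≫
          projToSpec (Fin (d + 1 + 1)) T.left.functionField = 𝟙 _ := by
        have hw' := Over.w (pointOfVec T.left.functionField (⇑φa ∘ u) (ProjectiveSpace.comp_ne_zero φa hu0))
        change (pointOfVec T.left.functionField (⇑φa ∘ u) (ProjectiveSpace.comp_ne_zero φa hu0)).left ≫
          projToSpec (Fin (d + 1 + 1)) T.left.functionField =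
            Spec.map (CommRingCat.ofHom (RingHom.id T.left.functionField)) at hw'
        rw [hw']
        exact Spec.map_id _
      exact hs1.trans (sPt_projToSpec (d + 1) T X i a' ha').symm
  -- the `p₀`-point
  let aT : Spec T.left.functionField ⟶ X.left := qgen T ≫ (ClosedSubvariety.ofPoint Y.left Q.pt).ι ≫ prX.left
  have haT_ha : aT ≫ X.hom = qgen T ≫ T.hom := by
    change (qgen T ≫ (ClosedSubvariety.ofPoint Y.left Q.pt).ι ≫ prX.left) ≫ X.hom =
      qgen T ≫ ((ClosedSubvariety.ofPoint Y.left Q.pt).ι ≫ Y.hom)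
    simp only [Category.assoc, Over.w prX]
  have hτι : τ ≫ (ClosedSubvariety.ofPoint Y.left Q.pt).ι ≫ prX.left = a₀.left := by
    rw [← Category.assoc, hτ1]; exact hQX'
  have haT : aT = Spec.map (CommRingCat.ofHom φ) ≫ a₀.left := by
    change qgen T ≫ (ClosedSubvariety.ofPoint Y.left Q.pt).ι ≫ prX.left = _
    exact ((congrArg (· ≫ ((ClosedSubvariety.ofPoint Y.left Q.pt).ι ≫ prX.left)) hqgen.symm).trans
      ((Category.assoc _ _ _).trans (congrArg (Spec.map (CommRingCat.ofHom φ) ≫ ·) hτι)))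
  have haTi : aT ≫ i.left = Spec.map (CommRingCat.ofHom φa.toRingHom) ≫ (pointOfVec k p₀ hp₀0).left := by
    rw [haT, Category.assoc]
    exact congrArg (Spec.map (CommRingCat.ofHom φ) ≫ ·) (congrArg CommaMorphism.left hPp)
  have hptp : (pointOfVec T.left.functionField x hx0).pt = uPt (d + 1) T X i aT haT_ha :=
    link aT haT_ha p₀ hp₀0 haTi
  haveI : @IsPreimmersion (Spec (CommRingCat.of (K₀))) X.left a₀.left :=
    ‹IsPreimmersion a₀.left›
  haveI hpreaT : IsPreimmersion aT := by rw [haT]; exact IsPreimmersion.comp _ _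
  have haTpt : aT.base (IsLocalRing.closedPoint _) = z := by
    rw [haT, ← ha₀z]
    change a₀.left.base ((Spec.map (CommRingCat.ofHom φ)).base (IsLocalRing.closedPoint _)) =
      a₀.left.base (IsLocalRing.closedPoint (K₀))
    congr 1
    exact Subsingleton.elim (α := PrimeSpectrum (K₀)) _ _
  -- the `p₀`-section pushes forward to `[S]`
  have hMa : AlgebraicCycle.map (CartesianMonoidalCategory.fst X T).left height height
      (primeCycle ((ιX T X).base (uXPt T X aT haT_ha))) = primeCycle z := by
    have hliftpt : (ιX T X).base (uXPt T X aT haT_ha) =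
        (liftPt T X aT haT_ha).base (IsLocalRing.closedPoint _) := by
      change ((tPt T X aT haT_ha ≫ ιX T X).base _) = _
      rw [tPt_ιX]
    rw [hliftpt]
    haveI : LocallyOfFiniteType ((CartesianMonoidalCategory.fst X T).left ≫ X.hom) :=
      inferInstanceAs (LocallyOfFiniteType (X ⊗ T).hom)
    rw [algebraicCycleMap_primeCycle_of_residueFieldMap_surjective
      (CartesianMonoidalCategory.fst X T).left X.hom ((liftPt T X aT haT_ha).base _) ?_]
    · rw [← haTpt]
      congr 1
      change ((liftPt T X aT haT_ha ≫ (CartesianMonoidalCategory.fst X T).left).base _) = _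
      rw [liftPt_fst]
    · refine residueFieldMap_surjective_of_comp (liftPt T X aT haT_ha) _ _ ?_
      have key : ∀ g : Spec T.left.functionField ⟶ X.left, g = aT →
          Function.Surjective (g.residueFieldMap (IsLocalRing.closedPoint _)) := by
        rintro g rfl; exact residueFieldMap_surjective_of_isPreimmersion _ _
      exact key _ (liftPt_fst T X aT haT_ha)
  have hR : restrictMapFst T X i (primeCycle (genericFibreι (d + 1) T
      (pointOfVec T.left.functionField x hx0).pt)) = primeCycle z := by
    have hjι : (i ▷ T).left.base ((ιX T X).base (uXPt T X aT haT_ha)) =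
        genericFibreι (d + 1) T ((iK (d + 1) T X i).base (uXPt T X aT haT_ha)) := by
      change ((ιX T X ≫ (i ▷ T).left).base _) = ((iK (d + 1) T X i ≫ genericFibreι (d + 1) T).base _)
      rw [iK_genericFibreι]
    rw [hptp, ← iK_uXPt, ← hjι, restrictMapFst_primeCycle_whiskerRight, hMa]
  refine ⟨a, Pl, hPl, ?_⟩
  rw [← hR]
  exact hrelT

/-- **`2 [S] - a · [X ∩ M] - (planes) ∈ Rat₂(X)` for every surface `S` of the cubic hypersurface
`X` (`d ≥ 14`)** — the second, coefficient-`2`, relation (Mboro, proof of Thm. 1.3: lines tangent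
to `X` aimed at a linear subspace of `X`; here at a plane `P ⊆ X`, which exists as `d + 1 ≥ 8`).
For every point `z ∈ X` of dimension `2` there are `a ∈ ℤ` and a cycle `Pl` on `X` supported on
plane points with `2 [closure {z}] - a · (V₊(ℓ_c)|_X ⋯ V₊(ℓ₁)|_X · [X]) - Pl ∈ Rat₂(X)`. (If the
generic point of `S` lies on the chosen plane, `S` is that plane.)
[cite: Mboro2018, proof of Thm. 1.3 (arXiv:1701.04488, p. 8)] -/
theorem exists_two_smul_primeCycle_sub_mem (hd : 14 ≤ d)
    (hF : F ∈ grading (Fin (d + 1 + 1)) k 3) (hprime : Prime F)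
    (hrange : Set.range i.left.base =
      ProjectiveSpectrum.zeroLocus (homogeneousSubmodule (Fin (d + 1 + 1)) k) {F})
    {c : ℕ} (hdim : 2 + c = d) (ℓ : Fin c → MvPolynomial (Fin (d + 1 + 1)) k)
    (hℓ : ∀ j, ℓ j ∈ grading (Fin (d + 1 + 1)) k 1) (hlin : LinearIndependent k ℓ)
    (hav : ∀ j, (formDivisor (ℓ j) (hℓ j) (hlin.ne_zero j)).Avoids (i.left.base (genericPoint ↥X.left)))
    (w : ↥(projectiveSpace (d + 1) k).left)
    (hw : (ProjectiveSpectrum.asHomogeneousIdeal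
      (𝒜 := homogeneousSubmodule (Fin (d + 1 + 1)) k) w).toIdeal = Ideal.span (Set.range ℓ))
    (hFw : F ∉ ProjectiveSpectrum.asHomogeneousIdeal (𝒜 := homogeneousSubmodule (Fin (d + 1 + 1)) k) w)
    (z : ↥X.left) (hz : height z = 2) :
    ∃ (a : ℤ) (Pl : AlgebraicCycle X.left ℤ), (∀ y, Pl y ≠ 0 → IsLinearSubspacePoint 2 (d + 1) i y) ∧
      2 • primeCycle z - a • CartierDivisor.iterInter c
          (fun j => (formDivisor (ℓ j) (hℓ j) (hlin.ne_zero j)).pullbackAvoiding i.left (hav j))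
          (primeCycle (genericPoint ↥X.left)) - Pl ∈ ratTrivial X.left 2 := by
  classical
  haveI : IsProper (projectiveSpace (d + 1) k).hom := isProper_projectiveSpace (d + 1) k
  haveI : IsProper X.hom := by rw [← Over.w i]; infer_instance
  have hF3 : F.IsHomogeneous 3 := (mem_homogeneousSubmodule 3 F).1 hF
  -- the generic point of `S = closure {z}` as a `K₀`-point, `K₀ = κ(z)`
  letI algK : Algebra k (X.left.residueField z) :=
    ((Scheme.ΓSpecIso (CommRingCat.of k)).inv ≫ X.hom.appTop ≫ X.left.Γevaluation z).hom.toAlgebra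
  have halg : Spec.map (CommRingCat.ofHom (algebraMap k (X.left.residueField z))) =
      X.left.fromSpecResidueField z ≫ X.hom :=
    Scheme.SpecMap_ΓSpecIso_inv_appTop_Γevaluation X.hom z
  let a₀ : AlgPoints X (X.left.residueField z) := AlgPoints.mk (X.left.fromSpecResidueField z) halg.symm
  haveI : IsPreimmersion a₀.left := inferInstanceAs (IsPreimmersion (X.left.fromSpecResidueField z))
  have ha₀z : a₀.pt = z := Scheme.fromSpecResidueField_apply z _
  have htr : Algebra.trdeg k (X.left.residueField z) = 2 := by
    have h := Scheme.height_eq_toENat_trdeg_residueField X.hom z halg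
    rw [hz] at h
    exact_mod_cast (Cardinal.toENat_eq_ofNat.mp h.symm)
  -- homogeneous coordinates `p₀` of the generic point; `F(p₀) = 0`
  obtain ⟨p₀, hp₀0, hPp⟩ := exists_eq_pointOfVec (AlgPoints.map i a₀)
  have hFp : eval p₀ (MvPolynomial.map (algebraMap k (X.left.residueField z)) F) = 0 := by
    have hmem : (pointOfVec k p₀ hp₀0).pt ∈ Set.range i.left.base := by
      rw [← hPp]; exact ⟨a₀.pt, rfl⟩
    rw [hrange] at hmem
    have h3 := (pt_pointOfVec_mem_zeroLocus_iff p₀ hp₀0 (by norm_num : 0 < 3)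
      ((mem_homogeneousSubmodule 3 F).mpr hF3)).1 hmem
    rw [MvPolynomial.eval_map]
    exact h3
  -- a plane `P = ℙ(W) ⊆ X` over `k`: an isotropic `3`-frame `a` and its equations `Lp`
  obtain ⟨av, hav', hiso⟩ := exists_linearIndependent_three_eval_cubic_eq_zero (N := d + 1) (by omega) hF3
  obtain ⟨t, Lp, htu, hLpli, hLphom, hLvan, hLideal⟩ := exists_linearForms_forall_mem_ideal_span_vanishing hav'
  have hFspan : F ∈ Ideal.span (Set.range Lp) :=
    hLideal F (forall_mem_span_range_eval_eq_zero hiso)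
  obtain ⟨yPℓ, hyPℓ, -, -⟩ := exists_point_of_linearIndependent Lp hLpli hLphom (by omega)
  have hyPℓX : yPℓ ∈ Set.range i.left.base := by
    rw [hrange]
    intro G hG
    rw [Set.mem_singleton_iff.mp hG]
    change F ∈ (ProjectiveSpectrum.asHomogeneousIdeal (𝒜 := homogeneousSubmodule (Fin (d + 1 + 1)) k) yPℓ).toIdeal
    rw [hyPℓ]
    exact hFspan
  obtain ⟨yP, hyP'⟩ := hyPℓX
  have hyP : (ProjectiveSpectrum.asHomogeneousIdeal
      (𝒜 := homogeneousSubmodule (Fin (d + 1 + 1)) k) (i.left.base yP)).toIdeal = Ideal.span (Set.range Lp) := by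
    rw [hyP']; exact hyPℓ
  have hyPl : IsLinearSubspacePoint 2 (d + 1) i yP := by
    have h := Hypersurface.isLinearSubspacePoint_of_toIdeal_base_eq_span (i := i) Lp hLpli hLphom (by omega) hyP
    rwa [show d + 1 - t = 2 by omega] at h
  -- the `K₀`-span `W` of the frame; the `L_j ⊗ 1` and `F ⊗ 1` vanish on it
  let K₀ := X.left.residueField z
  let W : Submodule K₀ (Fin (d + 1 + 1) → K₀) :=
    Submodule.span K₀ (Set.range fun j => (algebraMap k K₀) ∘ av j)
  have havK : LinearIndependent K₀ (fun j => (algebraMap k K₀) ∘ av j) :=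
    (linearIndependent_algebraMap_comp_iff (R := k) (S := K₀) (v := av)).2 hav'
  haveI : FiniteDimensional K₀ W := FiniteDimensional.span_of_finite K₀ (Set.finite_range _)
  have hW3 : Module.finrank (X.left.residueField z) W = 3 := by
    change Module.finrank K₀ (Submodule.span K₀ (Set.range fun j => (algebraMap k K₀) ∘ av j)) = 3
    rw [finrank_span_eq_card havK, Fintype.card_fin]
  have hevK : ∀ (G : MvPolynomial (Fin (d + 1 + 1)) k) (v : Fin (d + 1 + 1) → k),
      eval ((algebraMap k K₀) ∘ v) (MvPolynomial.map (algebraMap k K₀) G) = algebraMap k K₀ (eval v G) := by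
    intro G v
    rw [MvPolynomial.eval_map, show eval v G = eval₂ (RingHom.id k) v G from rfl, MvPolynomial.eval₂_comp_left,
      RingHom.comp_id]
  have hLK : ∀ j, ∀ v ∈ W, eval v (MvPolynomial.map (algebraMap k K₀) (Lp j)) = 0 := by
    intro j
    refine forall_mem_span_eval_eq_zero_of_isHomogeneous_one ((hLphom j).map _) ?_
    rintro _ ⟨j', rfl⟩
    rw [hevK, hLvan j (av j') (Submodule.subset_span ⟨j', rfl⟩), map_zero]
  have hisoK : ∀ v ∈ W, eval v (MvPolynomial.map (algebraMap k K₀) F) = 0 := by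
    intro v hv
    obtain ⟨cf, hcf⟩ := Ideal.mem_span_range_iff_exists_fun.1 hFspan
    rw [← hcf, map_sum, map_sum]
    refine Finset.sum_eq_zero fun j _ => ?_
    rw [map_mul, map_mul, hLK j v hv, mul_zero]
  by_cases hpW : p₀ ∈ W
  · -- the generic point of `S` lies on the plane: `S` is the plane
    have hiz : i.left.base z = (pointOfVec k p₀ hp₀0).pt := by
      have h1 : (AlgPoints.map i a₀).pt = i.left.base a₀.pt := rfl
      rw [← hPp, h1, ha₀z]
    have hsp : i.left.base yP ⤳ i.left.base z := by
      rw [specializes_iff_mem_closure, closure_singleton_eq_zeroLocus, hiz]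
      change (pointOfVec k p₀ hp₀0).pt ∈ ProjectiveSpectrum.zeroLocus _
        ((ProjectiveSpectrum.asHomogeneousIdeal (𝒜 := homogeneousSubmodule (Fin (d + 1 + 1)) k)
          (i.left.base yP)).toIdeal : Set (MvPolynomial (Fin (d + 1 + 1)) k))
      rw [hyP, ProjectiveSpectrum.zeroLocus_span]
      rintro _ ⟨j, rfl⟩
      have h := (pt_pointOfVec_mem_zeroLocus_iff p₀ hp₀0 zero_lt_one
        ((mem_homogeneousSubmodule 1 _).mpr (hLphom j))).2 (by
          have h' := hLK j p₀ hpW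
          rwa [MvPolynomial.eval_map] at h')
      exact h (Set.mem_singleton _)
    have hyP2 : height (i.left.base yP) = (2 : ℕ) := by
      rw [height_base_eq_of_isClosedImmersion' i.left yP, hyPl.height_eq]
    have hz2 : height (i.left.base z) = (2 : ℕ) := by
      rw [height_base_eq_of_isClosedImmersion' i.left z, hz]; rfl
    have hzy : yP = z := i.left.isClosedEmbedding.injective
      (eq_of_specializes_of_height_eq hsp (hz2.trans hyP2.symm) (by rw [hyP2]; exact WithTop.coe_lt_top _))
    refine ⟨0, 2 • primeCycle z, fun y hy => ?_, ?_⟩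
    · have hyz : y = z := by
        by_contra hne
        apply hy
        rw [Function.locallyFinsuppWithin.coe_nsmul, Pi.smul_apply, primeCycle_apply_of_ne hne, nsmul_zero]
      rw [hyz, ← hzy]; exact hyPl
    · rw [zero_smul, sub_zero, sub_self]
      exact AddSubgroup.zero_mem _
  · -- a tangent (or contained) direction in the plane through the generic point
    obtain ⟨β₀, hβW, c₀, hpβ, htan₀⟩ := exists_tangent_vector_mem (hF3.map _) hFp (W := W)
      (hW3.symm ▸ (by norm_num : (2 : ℕ) ≤ 3)) hisoK hpW
    exact exists_two_smul_primeCycle_sub_mem_of_tangent X i hd hF hprime hrange hdim ℓ hℓ hlin hav w hw hFw hLpli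
      hLphom (by omega) yP hyP htr a₀ ha₀z p₀ β₀ hpβ hp₀0 hPp (fun j => hLK j β₀ hβW) c₀ htan₀

/-! ### Combination with the osculating-line relation: `[S] ∈ ℤ · [X ∩ M] + ⟨planes⟩ + Rat₂(X)` -/

/-- **`[S] - a · [X ∩ M] - (planes) ∈ Rat₂(X)` for every surface `S` of an integral cubic
hypersurface `X ⊆ ℙᵈ⁺¹` (`d ≥ 14`)** — "putting the two steps together, we get
`(3-2)Γ + P_*(⋯) ∈ ℤ · H_X^{n-i}`" (Mboro, end of the proof of Thm. 1.3): the difference of the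
osculating-line relation `3 [S] - a₃ [X ∩ M] - Pl₃ ∈ Rat₂(X)`
(`exists_three_smul_primeCycle_sub_mem`, `Motives/OsculatingLinesChowTwo`) and the tangent-line
relation `2 [S] - a₂ [X ∩ M] - Pl₂ ∈ Rat₂(X)` (`exists_two_smul_primeCycle_sub_mem`).
[cite: Mboro2018, proof of Thm. 1.3 (arXiv:1701.04488, p. 8)] -/
theorem exists_primeCycle_sub_mem (hd : 14 ≤ d)
    (hF : F ∈ grading (Fin (d + 1 + 1)) k 3) (hprime : Prime F)
    (hrange : Set.range i.left.base =
      ProjectiveSpectrum.zeroLocus (homogeneousSubmodule (Fin (d + 1 + 1)) k) {F})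
    {c : ℕ} (hdim : 2 + c = d) (ℓ : Fin c → MvPolynomial (Fin (d + 1 + 1)) k)
    (hℓ : ∀ j, ℓ j ∈ grading (Fin (d + 1 + 1)) k 1) (hlin : LinearIndependent k ℓ)
    (hav : ∀ j, (formDivisor (ℓ j) (hℓ j) (hlin.ne_zero j)).Avoids (i.left.base (genericPoint ↥X.left)))
    (w : ↥(projectiveSpace (d + 1) k).left)
    (hw : (ProjectiveSpectrum.asHomogeneousIdeal
      (𝒜 := homogeneousSubmodule (Fin (d + 1 + 1)) k) w).toIdeal = Ideal.span (Set.range ℓ))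
    (hFw : F ∉ ProjectiveSpectrum.asHomogeneousIdeal (𝒜 := homogeneousSubmodule (Fin (d + 1 + 1)) k) w)
    (z : ↥X.left) (hz : height z = 2) :
    ∃ (a : ℤ) (Pl : AlgebraicCycle X.left ℤ), (∀ y, Pl y ≠ 0 → IsLinearSubspacePoint 2 (d + 1) i y) ∧
      primeCycle z - a • CartierDivisor.iterInter c
          (fun j => (formDivisor (ℓ j) (hℓ j) (hlin.ne_zero j)).pullbackAvoiding i.left (hav j))
          (primeCycle (genericPoint ↥X.left)) - Pl ∈ ratTrivial X.left 2 := by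
  obtain ⟨a₃, Pl₃, hPl₃, h₃⟩ := exists_three_smul_primeCycle_sub_mem X i hd hF hprime hrange hdim ℓ hℓ hlin hav
    w hw hFw z hz
  obtain ⟨a₂, Pl₂, hPl₂, h₂⟩ := exists_two_smul_primeCycle_sub_mem X i hd hF hprime hrange hdim ℓ hℓ hlin hav
    w hw hFw z hz
  refine ⟨a₃ - a₂, Pl₃ - Pl₂, fun y hy => ?_, ?_⟩
  · rw [Function.locallyFinsuppWithin.coe_sub, Pi.sub_apply] at hy
    by_cases h3 : Pl₃ y = 0
    · refine hPl₂ y fun h2 => hy ?_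
      rw [h3, h2, sub_zero]
    · exact hPl₃ y h3
  · have key : primeCycle z - (a₃ - a₂) • CartierDivisor.iterInter c
        (fun j => (formDivisor (ℓ j) (hℓ j) (hlin.ne_zero j)).pullbackAvoiding i.left (hav j))
        (primeCycle (genericPoint ↥X.left)) - (Pl₃ - Pl₂) =
        (3 • primeCycle z - a₃ • CartierDivisor.iterInter c
          (fun j => (formDivisor (ℓ j) (hℓ j) (hlin.ne_zero j)).pullbackAvoiding i.left (hav j))
          (primeCycle (genericPoint ↥X.left)) - Pl₃) -
        (2 • primeCycle z - a₂ • CartierDivisor.iterInter c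
          (fun j => (formDivisor (ℓ j) (hℓ j) (hlin.ne_zero j)).pullbackAvoiding i.left (hav j))
          (primeCycle (genericPoint ↥X.left)) - Pl₂) := by
      rw [sub_smul]
      have h32 : (3 : ℕ) • primeCycle z - 2 • primeCycle z = primeCycle z := by
        rw [show (3 : ℕ) = 2 + 1 from rfl, add_nsmul, one_nsmul, add_sub_cancel_left]
      rw [← h32]
      abel
    rw [key]
    exact AddSubgroup.sub_mem _ h₃ h₂

/-- **`[S] ∼ a · [X ∩ M] + Σ_y w_y [Π_y]` on the cubic hypersurface `X` (`d ≥ 14`), with finitely many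
planes `Π_y = closure {y} ⊆ X`** — `exists_primeCycle_sub_mem` as a rational equivalence with an
explicit finite plane sum. [cite: Mboro2018, Thm. 1.2 and proof of Thm. 1.3 (arXiv:1701.04488, pp. 6–8)] -/
theorem primeCycle_isRationallyEquivalent (hd : 14 ≤ d)
    (hF : F ∈ grading (Fin (d + 1 + 1)) k 3) (hprime : Prime F)
    (hrange : Set.range i.left.base =
      ProjectiveSpectrum.zeroLocus (homogeneousSubmodule (Fin (d + 1 + 1)) k) {F})
    {c : ℕ} (hdim : 2 + c = d) (ℓ : Fin c → MvPolynomial (Fin (d + 1 + 1)) k)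
    (hℓ : ∀ j, ℓ j ∈ grading (Fin (d + 1 + 1)) k 1) (hlin : LinearIndependent k ℓ)
    (hav : ∀ j, (formDivisor (ℓ j) (hℓ j) (hlin.ne_zero j)).Avoids (i.left.base (genericPoint ↥X.left)))
    (w : ↥(projectiveSpace (d + 1) k).left)
    (hw : (ProjectiveSpectrum.asHomogeneousIdeal
      (𝒜 := homogeneousSubmodule (Fin (d + 1 + 1)) k) w).toIdeal = Ideal.span (Set.range ℓ))
    (hFw : F ∉ ProjectiveSpectrum.asHomogeneousIdeal (𝒜 := homogeneousSubmodule (Fin (d + 1 + 1)) k) w)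
    (z : ↥X.left) (hz : height z = 2) :
    ∃ (a : ℤ) (s : Finset ↥X.left) (wt : ↥X.left → ℤ), (∀ y ∈ s, IsLinearSubspacePoint 2 (d + 1) i y) ∧
      IsRationallyEquivalent (primeCycle z)
        (a • CartierDivisor.iterInter c
          (fun j => (formDivisor (ℓ j) (hℓ j) (hlin.ne_zero j)).pullbackAvoiding i.left (hav j))
          (primeCycle (genericPoint ↥X.left)) + ∑ y ∈ s, wt y • primeCycle y) 2 := by
  classical
  haveI : IsProper (projectiveSpace (d + 1) k).hom := isProper_projectiveSpace (d + 1) k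
  haveI : IsProper X.hom := by rw [← Over.w i]; infer_instance
  haveI : CompactSpace ↥X.left := compactSpace_of_quasiCompact_hom X
  obtain ⟨a, Pl, hPl, hrat⟩ := exists_primeCycle_sub_mem X i hd hF hprime hrange hdim ℓ hℓ hlin hav w hw hFw z hz
  refine ⟨a, (finite_support_of_compactSpace Pl).toFinset, fun y => Pl y, fun y hy => hPl y
    (Function.mem_support.mp ((Set.Finite.mem_toFinset _).mp hy)), ?_⟩
  change _ - (_ + ∑ y ∈ (finite_support_of_compactSpace Pl).toFinset, Pl y • primeCycle y) ∈ ratTrivial X.left 2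
  rw [← eq_sum_smul_primeCycle_of_support_subset Pl (s := (finite_support_of_compactSpace Pl).toFinset)
    (by rw [Set.Finite.coe_toFinset]), ← sub_sub]
  exact hrat

/-- **`CH₂(X) = ℤ · (c₁(𝒪_X(1))^{d-2} ∩ [X]) + ⟨planes⟩`** for an integral cubic hypersurface
`X = V₊(F) ⊆ ℙᵈ⁺¹_k` (`k` algebraically closed, `d ≥ 14`): every class lies in the subgroup generated
by the class `H_X^{d-2} ∩ [X]` (`ProjSpace.hyperplaneSectionOnIter`, for any hyperplane `V₊(ℓ₀) ⊅ X`)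
and the plane classes (`linearSubspaceClasses 2`) — Mboro's "`(3-2)Γ + P_*(⋯) ∈ ℤ · H_X^{n-2}`"
with `P_*(⋯)` a combination of planes in this range. (`CH₂(X)` is generated by the `[closure {z}]`,
`dim z = 2`, and for those `primeCycle_isRationallyEquivalent`.)
[cite: Mboro2018, Thm. 1.2, Thm. 1.3 and Cor. 2.9 (arXiv:1701.04488, pp. 6–8, 12)] -/
theorem mem_zmultiples_sup_closure_linearSubspaceClasses (hd : 14 ≤ d)
    (hF : F ∈ grading (Fin (d + 1 + 1)) k 3) (hprime : Prime F)
    (hrange : Set.range i.left.base =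
      ProjectiveSpectrum.zeroLocus (homogeneousSubmodule (Fin (d + 1 + 1)) k) {F})
    {c : ℕ} (hdim : 2 + c = d) {ℓ₀ : MvPolynomial (Fin (d + 1 + 1)) k}
    (hℓ₀ : ℓ₀ ∈ grading (Fin (d + 1 + 1)) k 1) (hℓ₀0 : ℓ₀ ≠ 0)
    (hX₀ : (formDivisor ℓ₀ hℓ₀ hℓ₀0).Avoids (i.left.base (genericPoint ↥X.left)))
    (γ : ChowGroup X.left 2) :
    γ ∈ AddSubgroup.zmultiples (hyperplaneSectionOnIter i hℓ₀ hℓ₀0 hX₀ 2 c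
        (ChowGroup.mk X.left (2 + c) ⟨primeCycle (genericPoint ↥X.left), primeCycle_mem_cyclesOfDim
          (by rw [Hypersurface.height_genericPoint i hF hprime hrange]; exact_mod_cast hdim.symm)⟩)) ⊔
      AddSubgroup.closure (linearSubspaceClasses 2 (d + 1) i) := by
  classical
  haveI : IsProper (projectiveSpace (d + 1) k).hom := isProper_projectiveSpace (d + 1) k
  haveI : IsProper X.hom := by rw [← Over.w i]; infer_instance
  haveI : CompactSpace ↥X.left := compactSpace_of_quasiCompact_hom X
  have hF3 : F.IsHomogeneous 3 := (mem_homogeneousSubmodule 3 F).1 hF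
  -- a `3`-plane `M = V₊(ℓ₁, …, ℓ_c) ⊄ X` whose hyperplanes do not contain `X`
  obtain ⟨ℓ, hlin, hhom, hFℓ⟩ := exists_linearForms_not_mem_idealSpan (N := d + 1) three_pos hF3
    hprime.ne_zero (c := c) (by omega)
  have hℓ : ∀ j, ℓ j ∈ grading (Fin (d + 1 + 1)) k 1 :=
    fun j => (MvPolynomial.mem_homogeneousSubmodule 1 _).2 (hhom j)
  have hav : ∀ j, (formDivisor (ℓ j) (hℓ j) (hlin.ne_zero j)).Avoids
      (i.left.base (genericPoint ↥X.left)) := by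
    intro j
    refine Hypersurface.formDivisor_avoids_base_genericPoint i hF hprime hrange (hℓ j) (hlin.ne_zero j) fun h => hFℓ ?_
    exact Ideal.span_mono (Set.singleton_subset_iff.2 (Set.mem_range_self j)) h
  obtain ⟨w, hw, -, -⟩ := exists_point_of_linearIndependent ℓ hlin hhom (by omega)
  have hFw : F ∉ ProjectiveSpectrum.asHomogeneousIdeal
      (𝒜 := MvPolynomial.homogeneousSubmodule (Fin (d + 1 + 1)) k) w := by
    intro h
    apply hFℓ
    rw [← hw]
    exact h
  -- the target subgroup
  let G : AddSubgroup (ChowGroup X.left 2) :=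
    AddSubgroup.zmultiples (hyperplaneSectionOnIter i hℓ₀ hℓ₀0 hX₀ 2 c
        (ChowGroup.mk X.left (2 + c) ⟨primeCycle (genericPoint ↥X.left), primeCycle_mem_cyclesOfDim
          (by rw [Hypersurface.height_genericPoint i hF hprime hrange]; exact_mod_cast hdim.symm)⟩)) ⊔
      AddSubgroup.closure (linearSubspaceClasses 2 (d + 1) i)
  suffices hG : G = ⊤ by
    have hγ : γ ∈ G := by rw [hG]; exact AddSubgroup.mem_top γ
    exact hγ
  refine ChowGroup.eq_top_of_forall_ofPoint_mem fun z hz => ?_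
  obtain ⟨a, s, wt, hs, hrat⟩ := primeCycle_isRationallyEquivalent X i hd hF hprime hrange hdim
    ℓ hℓ hlin hav w hw hFw z hz
  -- in `CH₂(X)`
  have hdimX : primeCycle (genericPoint ↥X.left) ∈ cyclesOfDim X.left (2 + c) :=
    primeCycle_mem_cyclesOfDim (by rw [Hypersurface.height_genericPoint i hF hprime hrange]; exact_mod_cast hdim.symm)
  have hiter : CartierDivisor.iterInter c
      (fun j => (formDivisor (ℓ j) (hℓ j) (hlin.ne_zero j)).pullbackAvoiding i.left (hav j))
      (primeCycle (genericPoint ↥X.left)) ∈ cyclesOfDim X.left 2 :=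
    CartierDivisor.iterInter_mem_cyclesOfDim c _ hdimX
  have hsum : (∑ y ∈ s, wt y • primeCycle y) ∈ cyclesOfDim X.left 2 :=
    sum_zsmul_primeCycle_mem_cyclesOfDim_of_isLinearSubspacePoint wt hs
  have hmk : ChowGroup.ofPoint z hz =
      ChowGroup.mk X.left 2 ⟨a • CartierDivisor.iterInter c
          (fun j => (formDivisor (ℓ j) (hℓ j) (hlin.ne_zero j)).pullbackAvoiding i.left (hav j))
          (primeCycle (genericPoint ↥X.left)) + ∑ y ∈ s, wt y • primeCycle y,
        AddSubgroup.add_mem _ (AddSubgroup.zsmul_mem _ hiter a) hsum⟩ :=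
    ChowGroup.mk_eq_mk_iff.2 hrat
  have hsplit : ChowGroup.mk X.left 2 ⟨a • CartierDivisor.iterInter c
          (fun j => (formDivisor (ℓ j) (hℓ j) (hlin.ne_zero j)).pullbackAvoiding i.left (hav j))
          (primeCycle (genericPoint ↥X.left)) + ∑ y ∈ s, wt y • primeCycle y,
        AddSubgroup.add_mem _ (AddSubgroup.zsmul_mem _ hiter a) hsum⟩ =
      a • ChowGroup.mk X.left 2 ⟨_, hiter⟩ + ChowGroup.mk X.left 2 ⟨_, hsum⟩ := by
    rw [← map_zsmul, ← map_add]
    rfl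
  rw [hmk, hsplit]
  refine AddSubgroup.add_mem _ (AddSubgroup.mem_sup_left (AddSubgroup.zsmul_mem _ ?_ a))
    (AddSubgroup.mem_sup_right ?_)
  · rw [Hypersurface.mk_iterInter_primeCycle_eq_hyperplaneSectionOnIter i hF hprime hrange hdim ℓ hℓ
      (fun j => hlin.ne_zero j) hav hℓ₀ hℓ₀0 hX₀]
    exact AddSubgroup.mem_zmultiples _
  · -- a finite sum of plane classes
    have hγeq : (⟨∑ y ∈ s, wt y • primeCycle y, hsum⟩ : ↥(cyclesOfDim X.left 2)) =
        ∑ y ∈ s.attach, wt y • (⟨primeCycle (y : ↥X.left), (hs y y.2).primeCycle_mem⟩ : ↥(cyclesOfDim X.left 2)) := by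
      apply Subtype.ext
      rw [AddSubgroup.val_finsetSum]
      simp only [AddSubgroup.coe_zsmul]
      exact (Finset.sum_attach s fun y => wt y • primeCycle y).symm
    rw [hγeq, map_sum]
    refine AddSubgroup.sum_mem _ fun y _ => ?_
    rw [map_zsmul]
    refine AddSubgroup.zsmul_mem _ (AddSubgroup.subset_closure ?_) _
    exact ⟨(y : ↥X.left), hs y y.2, rfl⟩

end Main

end ProjFamily

end Literature.AlgebraicGeometry.Motives
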